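import Literature.AnabelianGeometry.AbsoluteAnabelian.AbsTopIThm26iiSigmaStarProofs
import Literature.AnabelianGeometry.AbsoluteAnabelian.AbsAnabRootClosedProofs
import HarnessLib

/-!
# [AbsTopI] Thm 2.6 (iii) from (∗)_Σ, step (a): the invariant character of a rank excess

S. Mochizuki, *Topics in Absolute Anabelian Geometry I: Generalities* (2012) [AbsTopI], proof of
Thm 2.6 (iii) p. 23 l. 41–45: "[since `δ¹_l(G) = 1`, by assertion (ii)] the fact that `δ¹_l(Π) ≥ 2`
implies that `l ∈ Σ`, and `dim_{ℚ_l}(R_l ⊗ ℚ_l) ≥ 1` [...].  But this implies that for any `l′ ∈ Σ`, we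
have `dim_{ℚ_{l′}}(R_{l′} ⊗ ℚ_{l′}) ≥ 1`".

PROOF-ONLY file (no definitions, no named facts) of the abc-iut row «HOOK-FROM-SIGMA-STAR» (seat
abc-iut-w6-d074): under condition (∗)_Σ (`FundamentalExtension.SigmaStarCondition S`, abc-iut-w6-d074
g2), an open `H ⊆ Π` with a rank excess `δ¹_{l₀}(G_H) < δ¹_{l₀}(H)` at some `l₀ ∈ Σ` has a (∗)_Σ-quotient
`Δ_H ↠ Ẑ_Σ^m` with `m ≥ 1` (by the coinvariant upper bound `δ¹(H) ≤ δ¹(G_H) + m`,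
`freeProlRank_open_eq_of_coinvQuotient_trivial`), whence for EVERY prime `l ∈ Σ` a non-zero
`H`-invariant continuous additive character `Δ_H → ℚ_l` (`exists_invariant_character_of_rankExcess`) —
the replacement, in the tree's vocabulary, of print's "`dim(R_{l′} ⊗ ℚ_{l′}) ≥ 1` for any `l′ ∈ Σ`".
HONEST FRAMING: refereed, undisputed paper; (∗)_Σ is a hypothesis on data; nothing here bears on
[IUTchIII] Cor. 3.12.
-/

noncomputable section

namespace Literature.AnabelianGeometry.AbsoluteAnabelian

namespace FundamentalExtension

variable {E : FundamentalExtension.{0}}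

/-- `Ẑ_Σ^m` is Hausdorff. [cite: MochizukiAbsTopI2012, Thm 2.6 (ii) proof p.23] -/
private theorem t2Space_hatZSigmaPow' (S : Set ℕ) (m : ℕ) : T2Space (HatZSigmaPow S m) :=
  inferInstanceAs (T2Space (Fin m → ∀ l : {l : ℕ // l.Prime ∧ l ∈ S}, @PadicInt l.1 ⟨l.2.1⟩))

/-- `Ẑ_Σ^0` is trivial. [cite: MochizukiAbsTopI2012, Thm 2.6 (ii) proof p.23] -/
private theorem subsingleton_hatZSigmaPow_zero (S : Set ℕ) : Subsingleton (HatZSigmaPow S 0) :=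
  inferInstanceAs (Subsingleton (Fin 0 → ∀ l : {l : ℕ // l.Prime ∧ l ∈ S}, @PadicInt l.1 ⟨l.2.1⟩))

/-- **(∗)_Σ at an open `H` with a rank excess: a non-zero `H`-invariant continuous additive character
`Δ_H → ℚ_l` at every prime `l ∈ Σ`** — the `l`-th coordinate of the (∗)_Σ-quotient `Δ_H ↠ Ẑ_Σ^m`,
`m ≥ 1` by the coinvariant upper bound `δ¹(H) ≤ δ¹(G_H) + m` (print: "`dim(R_l ⊗ ℚ_l) ≥ 1` [...]
implies that for any `l′ ∈ Σ`, `dim(R_{l′} ⊗ ℚ_{l′}) ≥ 1`"). [cite: MochizukiAbsTopI2012, Thm 2.6 (iii) proof p.23] -/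
theorem exists_invariant_character_of_rankExcess {S : Set ℕ} (hstar : E.SigmaStarCondition S)
    (H : Subgroup E.arith) (hH : IsOpen (H : Set E.arith)) {l₀ : ℕ} [Fact l₀.Prime]
    (hlt : freeProlRank ↥(H.map E.aug.toMonoidHom) l₀ < freeProlRank ↥H l₀)
    (l : ℕ) [Fact l.Prime] (hlS : l ∈ S) :
    ∃ ψ : ↥(E.geom ⊓ H) → ℚ_[l], Continuous ψ ∧ (∀ x y, ψ (x * y) = ψ x + ψ y) ∧
      (∀ (h : E.arith) (hh : h ∈ H) (x : ↥(E.geom ⊓ H)),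
        ψ ⟨h * x * h⁻¹, ⟨E.normal_geom.conj_mem _ x.2.1 h, H.mul_mem (H.mul_mem hh x.2.2) (H.inv_mem hh)⟩⟩
          = ψ x) ∧
      ∃ x₀ : ↥(E.geom ⊓ H), ψ x₀ = 1 := by
  classical
  obtain ⟨m, q, hq, hqiff⟩ := hstar H hH
  haveI : T2Space (HatZSigmaPow S m) := t2Space_hatZSigmaPow' S m
  -- `m ≠ 0` by the rank excess
  have hm : m ≠ 0 := by
    intro hm0
    subst hm0
    haveI : Subsingleton (HatZSigmaPow S 0) := subsingleton_hatZSigmaPow_zero S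
    have heq := E.freeProlRank_open_eq_of_coinvQuotient_trivial H hH q hq hqiff l₀
      (fun g _ hadd x => by
        have h1 : g 1 = 0 := by
          have := hadd 1 1
          rw [mul_one] at this
          linear_combination (-1 : ℚ_[l₀]) * this
        rw [Subsingleton.elim x 1, h1])
    exact hlt.ne heq.symm
  obtain ⟨L, hL⟩ := HatZSigmaPow.exists_proj (S := S) (m := m) l hlS
  let j₀ : Fin m := ⟨0, Nat.pos_of_ne_zero hm⟩
  refine ⟨fun x => ((Multiplicative.toAdd (L (q x)) j₀ : ℤ_[l]) : ℚ_[l]),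
    continuous_subtype_val.comp ((continuous_apply j₀).comp
      (continuous_toAdd.comp (L.continuous.comp q.continuous))),
    fun x y => by simp only [map_mul, toAdd_mul, Pi.add_apply, PadicInt.coe_add],
    fun h hh x => ?_, ?_⟩
  · -- invariance: `[h, x] ∈ R = ker q`
    have hmem : (⟨h * x * h⁻¹, ⟨E.normal_geom.conj_mem _ x.2.1 h,
        H.mul_mem (H.mul_mem hh x.2.2) (H.inv_mem hh)⟩⟩ : ↥(E.geom ⊓ H)) * x⁻¹ ∈
          q.toMonoidHom.ker := by
      rw [MonoidHom.mem_ker]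
      exact (hqiff _).2 (by
        simpa only [Subgroup.coe_mul, Subgroup.coe_inv] using E.commutator_mem_coinvRadical H hh x.2)
    rw [MonoidHom.mem_ker, map_mul, map_inv, mul_inv_eq_one] at hmem
    change ((Multiplicative.toAdd (L (q _)) j₀ : ℤ_[l]) : ℚ_[l]) = _
    rw [show q _ = q x from hmem]
  · -- a preimage of the `j₀`-th coordinate vector
    obtain ⟨x₀, hx₀⟩ := hq (Multiplicative.ofAdd (Pi.single j₀
      (fun l' : {l : ℕ // l.Prime ∧ l ∈ S} => (1 : @PadicInt l'.1 ⟨l'.2.1⟩))))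
    refine ⟨x₀, ?_⟩
    change ((Multiplicative.toAdd (L (q x₀)) j₀ : ℤ_[l]) : ℚ_[l]) = 1
    rw [hL, hx₀, toAdd_ofAdd, Pi.single_eq_same, PadicInt.coe_one]

end FundamentalExtension

end Literature.AnabelianGeometry.AbsoluteAnabelian
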